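import Literature.MathematicalPhysics.QuantumManyBody.PeriodicFeynmanKacOperatorProps
import Literature.MathematicalPhysics.QuantumManyBody.GroundStateFeynmanKacCompact
import Literature.Analysis.FunctionSpaces.ContinuousKernelCompactOperator
import HarnessLib

/-!
# Periodic Feynman–Kac: strong Feller property and compactness of `e^{-tH}` on `L²(cell)`

Topic `Literature/MathematicalPhysics/QuantumManyBody`; theorems only. Step of the proof of the
named fact `Literature.MathematicalPhysics.QuantumManyBody.BoseGas.PeriodicGroundStateFeynmanKac`
(`PeriodicHeatFlowSpectral.lean`); torus twin of `GroundStateFeynmanKacCompact.lean`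
(Chung–Zhao (1995), Props 3.11–3.12 and 3.15: `T_t` inherits the strong Feller property from
`P_t`, and is a compact operator on `L²(S)` when `m(S) < ∞`), for the Brownian motion of the flat
torus `S = ((ℝ/Lℤ)³)^N` and a BOUNDED periodised pair potential `v^per ≤ C`:

* `one_sub_toReal_periodicFKWeight_le` — the weight defect `1 - w_s ≤ N² C s` (no killing);
* `pfkReal_equicontinuous` — **uniform equicontinuity**: for `t > 0`, `M ≥ 0` and `ε > 0` there
  is `δ > 0` with `|(e^{-tH} g)(X) - (e^{-tH} g)(X')| ≤ ε` for all `X, X'` at distance `< δ` and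
  ALL periodic `g` with `‖g‖_{L²(cell)} ≤ M` (semigroup law `e^{-tH} = e^{-sH} e^{-(t-s)H}` with
  `s` small, the `L²(cell) → L^∞` bound on `h = e^{-(t-s)H} g`, the weight defect, and the
  translation continuity of the free heat kernel in `L¹`, `exists_delta_heatKernel` of the
  Dirichlet file — Chung–Zhao Prop 3.11: `P_δ T_{t-δ} f → T_t f` uniformly);
* `continuous_pfkReal` — **strong Feller property**: `X ↦ (e^{-tH} g)(X)` is continuous on all
  of `(ℝ³)^N` for every periodic `g ∈ L²(cell)` (the torus has no boundary);
* `continuous_pfkKernelVec` — the Riesz vector `κ_t(X) ∈ L²(cell)` of the evaluation functional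
  `g ↦ (e^{-tH} g)(X)` (the torus kernel `u_t(X, ·)`) depends continuously on `X`;
* `isCompactOperator_pfkL2` — **`e^{-tH_N^per}` is a compact operator on `L²([0,L)^{3N})`**
  (`t > 0`), by the tree's criterion
  `Literature.Analysis.FunctionSpaces.isCompactOperator_of_ae_eq_indicator_inner` applied on the
  compact closed cell `[0,L]^{3N} ⊇ [0,L)^{3N}` with the continuous kernel vector.

## References

* K. L. Chung, Z. Zhao, *From Brownian Motion to Schrödinger's Equation* (1995), Thm 2.2,
  Props 3.11, 3.12, 3.15. [ChungZhao1995]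
* M. Reed, B. Simon, *Methods of Modern Mathematical Physics I* (1980), Thm VI.12.
-/

noncomputable section

namespace Literature.MathematicalPhysics.QuantumManyBody.BoseGas

open MeasureTheory ProbabilityTheory Filter Set Metric
open scoped ENNReal NNReal Topology InnerProductSpace
open Literature.Probability.Process

variable {N : ℕ}

/-! ### The weight defect for a bounded periodised potential -/

/-- A bounded periodised pair potential gives a bounded periodic interaction:
`∑_{i<j} v^per ≤ N² C`. [folklore] -/
theorem periodicInteraction_le_of_bound {v : ℝ → ℝ≥0∞} {L : ℝ} {C : ℝ≥0∞}
    (hC : ∀ x, periodizedPotential v L x ≤ C) (X : Config N) :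
    periodicInteraction v L X ≤ (N * N : ℕ) * C := by
  unfold periodicInteraction
  calc ∑ i : Fin N, ∑ j ∈ Finset.univ.filter (fun j => i < j), periodizedPotential v L (X i - X j)
      ≤ ∑ _i : Fin N, ∑ _j : Fin N, C := by
        refine Finset.sum_le_sum fun i _ => ?_
        exact (Finset.sum_le_sum fun j _ => hC _).trans
          (Finset.sum_le_sum_of_subset_of_nonneg (Finset.filter_subset _ _) fun _ _ _ => bot_le)
    _ = (N * N : ℕ) * C := by
        simp only [Finset.sum_const, Finset.card_univ, Fintype.card_fin, Nat.cast_mul, nsmul_eq_mul]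
        ring

/-- The periodised action up to time `s ≥ 0` is at most `N² C s` for `v^per ≤ C`. [folklore] -/
theorem periodicPathAction_le_of_bound {v : ℝ → ℝ≥0∞} {L : ℝ} {C : ℝ≥0∞}
    (hC : ∀ x, periodizedPotential v L x ≤ C) (s : ℝ) (X : Config N) (ω : PathSpace N) :
    periodicPathAction v L s X ω ≤ (N * N : ℕ) * C * ENNReal.ofReal s := by
  unfold periodicPathAction
  calc ∫⁻ r in Set.Ioc (0 : ℝ) s, periodicInteraction v L (worldLine X ω r.toNNReal)
      ≤ ∫⁻ _r in Set.Ioc (0 : ℝ) s, (N * N : ℕ) * C :=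
        lintegral_mono fun r => periodicInteraction_le_of_bound hC _
    _ = (N * N : ℕ) * C * ENNReal.ofReal s := by
        rw [setLIntegral_const, Real.volume_Ioc, sub_zero]

/-- **Weight defect for a bounded periodised potential**: `1 - w_s(X, ω) ≤ N² C s` (`v^per ≤ C`,
`s ≥ 0`): `w = e^{-∫₀ˢ V^per} ≥ e^{-N²Cs} ≥ 1 - N² C s` (no killing on the torus). [folklore] -/
theorem one_sub_toReal_periodicFKWeight_le {v : ℝ → ℝ≥0∞} {L : ℝ} {C : ℝ≥0}
    (hC : ∀ x, periodizedPotential v L x ≤ C) {s : ℝ} (hs : 0 ≤ s) (X : Config N)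
    (ω : PathSpace N) :
    1 - (periodicFKWeight v L s X ω).toReal ≤ (N * N : ℕ) * C * s := by
  have hA : periodicPathAction v L s X ω ≤ (N * N : ℕ) * (C : ℝ≥0∞) * ENNReal.ofReal s :=
    periodicPathAction_le_of_bound (C := (C : ℝ≥0∞)) (fun x => hC x) s X ω
  have hM : ((N * N : ℕ) * (C : ℝ≥0∞) * ENNReal.ofReal s) ≠ ⊤ :=
    ENNReal.mul_ne_top (ENNReal.mul_ne_top (ENNReal.natCast_ne_top _) ENNReal.coe_ne_top)
      ENNReal.ofReal_ne_top
  have hw : (expNeg ((N * N : ℕ) * (C : ℝ≥0∞) * ENNReal.ofReal s)).toReal ≤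
      (expNeg (periodicPathAction v L s X ω)).toReal :=
    ENNReal.toReal_mono ((expNeg_le_one _).trans_lt ENNReal.one_lt_top).ne (expNeg_antitone hA)
  have hexp : (expNeg ((N * N : ℕ) * (C : ℝ≥0∞) * ENNReal.ofReal s)).toReal =
      Real.exp (-((N * N : ℕ) * C * s)) := by
    rw [expNeg, if_neg hM, ENNReal.toReal_ofReal (Real.exp_pos _).le]
    congr 2
    rw [ENNReal.toReal_mul, ENNReal.toReal_mul, ENNReal.toReal_ofReal hs]
    simp
  rw [hexp] at hw
  have h1 : 1 - (N * N : ℕ) * (C : ℝ) * s ≤ Real.exp (-((N * N : ℕ) * C * s)) := by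
    have := Real.add_one_le_exp (-((N * N : ℕ) * (C : ℝ) * s))
    linarith
  rw [periodicFKWeight]
  linarith

/-- **Interaction defect of the functional against the free expectation**: for a bounded
measurable `h` (`|h| ≤ K`), `s ≥ 0` and `v^per ≤ C`,
`|(e^{-sH} h)(X) - E[h(X + √2 b_s)]| ≤ K N² C s`. [folklore] -/
theorem abs_pfkReal_sub_integral_worldLine_le {v : ℝ → ℝ≥0∞} {L : ℝ} {C : ℝ≥0}
    (hC : ∀ x, periodizedPotential v L x ≤ C) (hv : Measurable v) {s : ℝ} (hs : 0 ≤ s)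
    {h : Config N → ℝ} (hh : Measurable h) {K : ℝ} (hK : ∀ Y, |h Y| ≤ K) (X : Config N) :
    |pfkReal v L s h X - ∫ ω, h (worldLine X ω s.toNNReal) ∂wienerPaths N| ≤
      K * ((N * N : ℕ) * C * s) := by
  have hK0 : 0 ≤ K := (abs_nonneg _).trans (hK 0)
  have hwm : Measurable fun ω : PathSpace N => (periodicFKWeight v L s X ω).toReal :=
    (measurable_periodicFKWeight hv L s X).ennreal_toReal
  have hhm : Measurable fun ω : PathSpace N => h (worldLine X ω s.toNNReal) :=
    hh.comp (measurable_worldLine X _)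
  have hw1 : ∀ ω, (periodicFKWeight v L s X ω).toReal ≤ 1 := fun ω =>
    toReal_periodicFKWeight_le_one v L s X ω
  have hi1 : Integrable (fun ω : PathSpace N =>
      (periodicFKWeight v L s X ω).toReal * h (worldLine X ω s.toNNReal)) (wienerPaths N) := by
    refine (integrable_const K).mono' (hwm.mul hhm).aestronglyMeasurable
      (Eventually.of_forall fun ω => ?_)
    rw [Real.norm_eq_abs, abs_mul, abs_of_nonneg ENNReal.toReal_nonneg]
    calc (periodicFKWeight v L s X ω).toReal * |h (worldLine X ω s.toNNReal)| ≤ 1 * K :=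
          mul_le_mul (hw1 ω) (hK _) (abs_nonneg _) zero_le_one
      _ = K := one_mul K
  have hi2 : Integrable (fun ω : PathSpace N => h (worldLine X ω s.toNNReal)) (wienerPaths N) :=
    (integrable_const K).mono' hhm.aestronglyMeasurable
      (Eventually.of_forall fun ω => by rw [Real.norm_eq_abs]; exact hK _)
  rw [pfkReal, ← integral_sub hi1 hi2]
  calc |∫ ω, ((periodicFKWeight v L s X ω).toReal * h (worldLine X ω s.toNNReal) -
        h (worldLine X ω s.toNNReal)) ∂wienerPaths N|
      ≤ ∫ ω, |(periodicFKWeight v L s X ω).toReal * h (worldLine X ω s.toNNReal) -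
        h (worldLine X ω s.toNNReal)| ∂wienerPaths N := abs_integral_le_integral_abs
    _ ≤ ∫ _ω, K * ((N * N : ℕ) * C * s) ∂wienerPaths N := by
        refine integral_mono_of_nonneg (Eventually.of_forall fun ω => abs_nonneg _)
          (integrable_const _) (Eventually.of_forall fun ω => ?_)
        dsimp only
        rw [show (periodicFKWeight v L s X ω).toReal * h (worldLine X ω s.toNNReal) -
            h (worldLine X ω s.toNNReal) =
            -((1 - (periodicFKWeight v L s X ω).toReal) * h (worldLine X ω s.toNNReal)) by ring,
          abs_neg, abs_mul, abs_of_nonneg (sub_nonneg.2 (hw1 ω)), mul_comm]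
        exact mul_le_mul (hK _) (one_sub_toReal_periodicFKWeight_le hC hs X ω)
          (sub_nonneg.2 (hw1 ω)) hK0
    _ = K * ((N * N : ℕ) * C * s) := by
        rw [integral_const, smul_eq_mul, probReal_univ, one_mul]

/-! ### Uniform equicontinuity -/

/-- **Sup bound for `e^{-τH} g` in terms of the `L²(cell)` mass, uniformly for `τ ≥ t₀ > 0`**:
`|(e^{-τH} g)(Y)| ≤ (pHeatConst N L t₀ |cell|^{1/2}) M` if `‖g‖_{L²(cell)} ≤ M` (`g` periodic).
[folklore] -/
theorem abs_pfkReal_le_pHeatConst (v : ℝ → ℝ≥0∞) {L : ℝ} (hL : 0 < L) {t₀ τ : ℝ} (ht₀ : 0 < t₀)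
    (hτ : t₀ ≤ τ) {g : Config N → ℝ} (hg : Measurable g)
    (hper : ∀ (Y : Config N) (i : Fin N) (k : Fin 3),
      g (Y + Pi.single i (EuclideanSpace.single k L)) = g Y)
    {M : ℝ} (hM : 0 ≤ M)
    (hg2 : (∫⁻ Y in cellN N L, ‖g Y‖ₑ ^ (2 : ℝ)) ^ (1 / 2 : ℝ) ≤ ENNReal.ofReal M) (Y : Config N) :
    |pfkReal v L τ g Y| ≤
      (pHeatConst N L t₀.toNNReal * volume (cellN N L) ^ (1 / 2 : ℝ)).toReal * M := by
  have h1 := enorm_pfkReal_le_L2cell v hL (ht₀.trans_le hτ) hg hper Y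
  have hanti : pHeatConst N L τ.toNNReal ≤ pHeatConst N L t₀.toNNReal :=
    pHeatConst_antitone N L (by simpa using ht₀) (Real.toNNReal_le_toNNReal hτ)
  have h2 := h1.trans (mul_le_mul' (mul_le_mul' hanti le_rfl) hg2)
  have hfin : pHeatConst N L t₀.toNNReal * volume (cellN N L) ^ (1 / 2 : ℝ) ≠ ⊤ :=
    ENNReal.mul_ne_top (pHeatConst_ne_top N hL _)
      (ENNReal.rpow_ne_top_of_nonneg (by norm_num) (volume_cellN_ne_top N L))
  calc |pfkReal v L τ g Y| = (‖pfkReal v L τ g Y‖ₑ).toReal := by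
        rw [Real.enorm_eq_ofReal_abs, ENNReal.toReal_ofReal (abs_nonneg _)]
    _ ≤ (pHeatConst N L t₀.toNNReal * volume (cellN N L) ^ (1 / 2 : ℝ) * ENNReal.ofReal M).toReal :=
        ENNReal.toReal_mono (ENNReal.mul_ne_top hfin ENNReal.ofReal_ne_top) h2
    _ = _ := by rw [ENNReal.toReal_mul, ENNReal.toReal_ofReal hM]

/-- **Uniform equicontinuity of `e^{-tH}` on `L²(cell)`-bounded sets of periodic observables**
(the heart of the strong Feller property and of compactness): for a bounded periodised potential
`v^per ≤ C`, `t > 0`, `M ≥ 0` and `ε > 0` there is `δ > 0` such that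
`|(e^{-tH} g)(X) - (e^{-tH} g)(X')| ≤ ε` whenever `dist X X' < δ` and `g` is periodic, measurable,
with `‖g‖_{L²(cell)} ≤ M`. Chung–Zhao (1995), Props 3.11–3.12 (`P_δ T_{t-δ} f → T_t f` uniformly;
strong Feller property of `T_t`). [cite: ChungZhao1995, Prop 3.12] -/
theorem pfkReal_equicontinuous {v : ℝ → ℝ≥0∞} (hv : Measurable v) {L : ℝ} (hL : 0 < L) {C : ℝ≥0}
    (hC : ∀ x, periodizedPotential v L x ≤ C) {t : ℝ} (ht : 0 < t) {M : ℝ} (hM : 0 ≤ M)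
    {ε : ℝ} (hε : 0 < ε) :
    ∃ δ > 0, ∀ X X' : Config N, dist X X' < δ →
      ∀ g : Config N → ℝ, Measurable g →
        (∀ (Y : Config N) (i : Fin N) (k : Fin 3),
          g (Y + Pi.single i (EuclideanSpace.single k L)) = g Y) →
        (∫⁻ Y in cellN N L, ‖g Y‖ₑ ^ (2 : ℝ)) ^ (1 / 2 : ℝ) ≤ ENNReal.ofReal M →
          |pfkReal v L t g X - pfkReal v L t g X'| ≤ ε := by
  -- the uniform sup bound `K` on `h = e^{-(t-s)H} g` for `s ≤ t/2`
  set K : ℝ := (pHeatConst N L (t / 2).toNNReal * volume (cellN N L) ^ (1 / 2 : ℝ)).toReal * M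
    with hK
  have hK0 : 0 ≤ K := mul_nonneg ENNReal.toReal_nonneg hM
  -- the small time `s ∈ (0, t/2]` with `K N² C s ≤ ε / 4`
  set A : ℝ := K * ((N * N : ℕ) * C) with hA
  have hA0 : 0 ≤ A := by positivity
  set s : ℝ := min (t / 2) (ε / (4 * (A + 1))) with hs
  have hs0 : 0 < s := lt_min (half_pos ht) (by positivity)
  have hst : s ≤ t / 2 := min_le_left _ _
  have hts : 0 < t - s := by linarith
  have hsε : K * ((N * N : ℕ) * C * s) ≤ ε / 4 := by
    have h1 : K * ((N * N : ℕ) * C * s) = A * s := by rw [hA]; ring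
    rw [h1]
    calc A * s ≤ A * (ε / (4 * (A + 1))) := mul_le_mul_of_nonneg_left (min_le_right _ _) hA0
      _ = (A / (A + 1)) * (ε / 4) := by field_simp
      _ ≤ 1 * (ε / 4) := by
          refine mul_le_mul_of_nonneg_right ?_ (by positivity)
          rw [div_le_one (by linarith)]; linarith
      _ = ε / 4 := one_mul _
  have hs0' : s.toNNReal ≠ 0 := by simpa using hs0
  -- the spatial modulus at time `s`
  obtain ⟨δ, hδ, hmod⟩ := exists_delta_heatKernel N hs0'
    (show 0 < ε / (4 * (K + 1)) by positivity)
  refine ⟨δ, hδ, fun X X' hXX' g hg hper hg2 => ?_⟩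
  have hXX'' : ‖X' - X‖ < δ := by rwa [← dist_eq_norm, dist_comm]
  -- `h = e^{-(t-s)H} g`, periodic, bounded by `K`
  set h : Config N → ℝ := pfkReal v L (t - s) g with hh
  have hhm : Measurable h := measurable_pfkReal hv L _ hg
  have hhK : ∀ Y, |h Y| ≤ K := fun Y =>
    abs_pfkReal_le_pHeatConst v hL (half_pos ht) (by linarith) hg hper hM hg2 Y
  -- the semigroup law `e^{-tH} g = e^{-sH} h`
  have hg2' : ∫⁻ Y in cellN N L, ‖g Y‖ₑ ^ (2 : ℝ) ≠ ⊤ := by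
    intro htop
    rw [htop, ENNReal.top_rpow_of_pos (by norm_num)] at hg2
    exact ENNReal.ofReal_ne_top (top_le_iff.1 hg2)
  have hsemi : ∀ Y, pfkReal v L t g Y = pfkReal v L s h Y := by
    intro Y
    have := pfkReal_add_time hv hL hs0 hts hg hper hg2' Y
    rwa [add_sub_cancel] at this
  -- the interaction defect at `X` and `X'`
  have hfree : ∀ Y : Config N,
      |pfkReal v L s h Y - ∫ ω, h (worldLine Y ω s.toNNReal) ∂wienerPaths N| ≤ ε / 4 := fun Y =>
    (abs_pfkReal_sub_integral_worldLine_le hC hv hs0.le hhm hhK Y).trans hsε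
  -- the free part
  have hP : |(∫ ω, h (worldLine X ω s.toNNReal) ∂wienerPaths N) -
      ∫ ω, h (worldLine X' ω s.toNNReal) ∂wienerPaths N| ≤ ε / 4 := by
    have h1 := abs_integral_worldLine_sub_le X X' hs0' hhm hhK
    rw [integral_abs_heatKernel_sub_eq X X' s.toNNReal] at h1
    have h2 := hmod (X' - X) hXX''
    have h3 : K / (K + 1) ≤ 1 := by rw [div_le_one (by linarith)]; linarith
    calc _ ≤ _ := h1
      _ ≤ K * (ε / (4 * (K + 1))) := mul_le_mul_of_nonneg_left h2 hK0
      _ = (K / (K + 1)) * (ε / 4) := by field_simp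
      _ ≤ 1 * (ε / 4) := mul_le_mul_of_nonneg_right h3 (by positivity)
      _ = ε / 4 := one_mul _
  calc |pfkReal v L t g X - pfkReal v L t g X'|
      = |pfkReal v L s h X - pfkReal v L s h X'| := by rw [hsemi X, hsemi X']
    _ ≤ |pfkReal v L s h X - ∫ ω, h (worldLine X ω s.toNNReal) ∂wienerPaths N| +
        |(∫ ω, h (worldLine X ω s.toNNReal) ∂wienerPaths N) -
          ∫ ω, h (worldLine X' ω s.toNNReal) ∂wienerPaths N| +
        |(∫ ω, h (worldLine X' ω s.toNNReal) ∂wienerPaths N) - pfkReal v L s h X'| :=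
        (abs_sub_le _ _ _).trans (add_le_add (abs_sub_le _ _ _) le_rfl)
    _ ≤ ε / 4 + ε / 4 + ε / 4 := by
        refine add_le_add (add_le_add (hfree X) hP) ?_
        rw [abs_sub_comm]
        exact hfree X'
    _ ≤ ε := by linarith

/-! ### Strong Feller property -/

/-- **Strong Feller property of `e^{-tH_N^per}`**: for `t > 0` and `g` periodic, measurable and
square integrable on the cell, `X ↦ (e^{-tH} g)(X)` is continuous on all of `(ℝ³)^N` (indeed
uniformly continuous). Chung–Zhao (1995), Prop 3.12. [cite: ChungZhao1995, Prop 3.12] -/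
theorem continuous_pfkReal {v : ℝ → ℝ≥0∞} (hv : Measurable v) {L : ℝ} (hL : 0 < L) {C : ℝ≥0}
    (hC : ∀ x, periodizedPotential v L x ≤ C) {t : ℝ} (ht : 0 < t) {g : Config N → ℝ}
    (hg : Measurable g)
    (hper : ∀ (Y : Config N) (i : Fin N) (k : Fin 3),
      g (Y + Pi.single i (EuclideanSpace.single k L)) = g Y)
    (hg2 : ∫⁻ Y in cellN N L, ‖g Y‖ₑ ^ (2 : ℝ) ≠ ⊤) : Continuous (pfkReal v L t g) := by
  rw [Metric.continuous_iff]
  intro X₀ ε hε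
  set M : ℝ := ((∫⁻ Y in cellN N L, ‖g Y‖ₑ ^ (2 : ℝ)) ^ (1 / 2 : ℝ)).toReal with hM
  have hM0 : 0 ≤ M := ENNReal.toReal_nonneg
  have hgM : (∫⁻ Y in cellN N L, ‖g Y‖ₑ ^ (2 : ℝ)) ^ (1 / 2 : ℝ) ≤ ENNReal.ofReal M := by
    rw [hM, ENNReal.ofReal_toReal (ENNReal.rpow_ne_top_of_nonneg (by norm_num) hg2)]
  obtain ⟨δ, hδ, hεδ⟩ := pfkReal_equicontinuous hv hL hC ht hM0 (half_pos hε)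
  refine ⟨δ, hδ, fun X hX => ?_⟩
  rw [Real.dist_eq]
  exact (hεδ X X₀ hX g hg hper hgM).trans_lt (half_lt_self hε)

/-- Continuity of `e^{-tH} g` for an `L²(cell)` class `g`, read through its periodic extension.
[folklore] -/
theorem continuous_pfkReal_coeFn {v : ℝ → ℝ≥0∞} (hv : Measurable v) {L : ℝ} (hL : 0 < L)
    {C : ℝ≥0} (hC : ∀ x, periodizedPotential v L x ≤ C) {t : ℝ} (ht : 0 < t)
    (g : Lp ℝ 2 (volume.restrict (cellN N L))) :
    Continuous (pfkReal v L t (⇑g ∘ cellProj L)) :=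
  continuous_pfkReal hv hL hC ht ((measurable_coeFn_Lp_cellN g).comp (measurable_cellProj L))
    (comp_cellProj_periodic hL.ne' _) (setLIntegral_cellN_enorm_comp_cellProj_sq_ne_top hL g)

/-! ### The kernel vector `u_t(X, ·) ∈ L²(cell)` -/

/-- The `L²(cell)` norm of a class is the square root of its cell mass. [folklore] -/
theorem ofReal_norm_Lp_cellN {L : ℝ} (g : Lp ℝ 2 (volume.restrict (cellN N L))) :
    ENNReal.ofReal ‖g‖ = (∫⁻ Y in cellN N L, ‖g Y‖ₑ ^ (2 : ℝ)) ^ (1 / 2 : ℝ) := by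
  rw [Lp.norm_def, ← eLpNorm_two_eq_cellN, ENNReal.ofReal_toReal (Lp.eLpNorm_ne_top g)]

/-- **Equicontinuity read on the unit ball of `L²(cell)`**: with `δ` from `pfkReal_equicontinuous`
for `M = 1`, `|(e^{-tH} g)(X) - (e^{-tH} g)(X')| ≤ ε ‖g‖` for every class `g` (scaling).
[folklore] -/
theorem abs_pfkReal_sub_le_mul_norm (v : ℝ → ℝ≥0∞) {L : ℝ} (hL : 0 < L) {t : ℝ} (ht : 0 < t)
    {ε : ℝ} {X X' : Config N}
    (h : ∀ g : Config N → ℝ, Measurable g →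
      (∀ (Y : Config N) (i : Fin N) (k : Fin 3),
        g (Y + Pi.single i (EuclideanSpace.single k L)) = g Y) →
      (∫⁻ Y in cellN N L, ‖g Y‖ₑ ^ (2 : ℝ)) ^ (1 / 2 : ℝ) ≤ ENNReal.ofReal 1 →
        |pfkReal v L t g X - pfkReal v L t g X'| ≤ ε)
    (g : Lp ℝ 2 (volume.restrict (cellN N L))) :
    |pfkReal v L t (⇑g ∘ cellProj L) X - pfkReal v L t (⇑g ∘ cellProj L) X'| ≤ ε * ‖g‖ := by
  rcases eq_or_ne ‖g‖ 0 with h0 | h0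
  · -- `g = 0`: both values vanish
    have hg0 : g = 0 := norm_eq_zero.1 h0
    have hae : (g : Config N → ℝ) =ᵐ[volume.restrict (cellN N L)] (0 : Config N → ℝ) := by
      rw [hg0]; exact Lp.coeFn_zero _ _ _
    rw [pfkReal_comp_cellProj_congr_ae v hL ht hae X, pfkReal_comp_cellProj_congr_ae v hL ht hae X',
      h0, mul_zero]
    simp [pfkReal]
  · have hpos : 0 < ‖g‖ := lt_of_le_of_ne (norm_nonneg _) (Ne.symm h0)
    -- the normalised periodic representative `g' = ‖g‖⁻¹ (g ∘ cellProj)`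
    set gp : Config N → ℝ := ⇑g ∘ cellProj L with hgp
    have hgpm : Measurable gp := (measurable_coeFn_Lp_cellN g).comp (measurable_cellProj L)
    have hgpper : ∀ (Y : Config N) (i : Fin N) (k : Fin 3),
        gp (Y + Pi.single i (EuclideanSpace.single k L)) = gp Y := comp_cellProj_periodic hL.ne' _
    set g' : Config N → ℝ := ‖g‖⁻¹ • gp with hg'
    have hg'm : Measurable g' := hgpm.const_smul _
    have hg'per : ∀ (Y : Config N) (i : Fin N) (k : Fin 3),
        g' (Y + Pi.single i (EuclideanSpace.single k L)) = g' Y := fun Y i k => by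
      simp only [hg', Pi.smul_apply, hgpper]
    have hmass : (∫⁻ Y in cellN N L, ‖g' Y‖ₑ ^ (2 : ℝ)) ^ (1 / 2 : ℝ) ≤ ENNReal.ofReal 1 := by
      have hsm : ∀ Y, ‖g' Y‖ₑ ^ (2 : ℝ) = ENNReal.ofReal (‖g‖⁻¹) ^ (2 : ℝ) * ‖gp Y‖ₑ ^ (2 : ℝ) := by
        intro Y
        rw [hg', Pi.smul_apply, smul_eq_mul, enorm_mul, ENNReal.mul_rpow_of_nonneg _ _ (by norm_num),
          Real.enorm_of_nonneg (inv_nonneg.2 (norm_nonneg _))]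
      simp_rw [hsm]
      rw [lintegral_const_mul _ (hgpm.enorm.pow_const _),
        ENNReal.mul_rpow_of_nonneg _ _ (by norm_num), ← ENNReal.rpow_mul,
        setLIntegral_cellN_enorm_comp_cellProj_sq hL]
      have h21 : (2 : ℝ) * (1 / 2) = 1 := by norm_num
      rw [h21, ENNReal.rpow_one, ← ofReal_norm_Lp_cellN g,
        ← ENNReal.ofReal_mul (inv_nonneg.2 (norm_nonneg _)), inv_mul_cancel₀ h0]
    have key := h g' hg'm hg'per hmass
    have hsc : ∀ Y, pfkReal v L t g' Y = ‖g‖⁻¹ * pfkReal v L t gp Y := fun Y =>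
      pfkReal_smul v L t _ _ Y
    rw [hsc, hsc, ← mul_sub, abs_mul, abs_of_pos (inv_pos.2 hpos)] at key
    rwa [inv_mul_le_iff₀ hpos, mul_comm] at key

/-- **The kernel vector `κ_t(X) ∈ L²(cell)` depends continuously on `X`**: the Riesz vector of
the evaluation functional `g ↦ (e^{-tH} g)(X)` (`pfkEval v L t X`), i.e. the torus kernel
`u_t(X, ·)`, is continuous as an `L²(cell)`-valued map (equicontinuity on the unit ball).
Chung–Zhao (1995), Prop 3.14 (`u_t ∈ C_b(S × S)`). [cite: ChungZhao1995, Prop 3.14] -/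
theorem continuous_pfkKernelVec {v : ℝ → ℝ≥0∞} (hv : Measurable v) {L : ℝ} (hL : 0 < L)
    {C : ℝ≥0} (hC : ∀ x, periodizedPotential v L x ≤ C) {t : ℝ} (ht : 0 < t) :
    Continuous (fun X : Config N =>
      (InnerProductSpace.toDual ℝ (Lp ℝ 2 (volume.restrict (cellN N L)))).symm (pfkEval v L t X)) := by
  rw [Metric.continuous_iff]
  intro X₀ ε hε
  obtain ⟨δ, hδ, hεδ⟩ := pfkReal_equicontinuous (N := N) hv hL hC ht zero_le_one (half_pos hε)
  refine ⟨δ, hδ, fun X hX => ?_⟩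
  rw [dist_eq_norm, ← LinearIsometryEquiv.map_sub, LinearIsometryEquiv.norm_map]
  refine lt_of_le_of_lt (ContinuousLinearMap.opNorm_le_bound _ (half_pos hε).le fun g => ?_)
    (half_lt_self hε)
  rw [FunLike.coe_sub, Pi.sub_apply, pfkEval_apply hv hL ht, pfkEval_apply hv hL ht,
    Real.norm_eq_abs]
  exact abs_pfkReal_sub_le_mul_norm v hL ht (fun g hg hgper hg1 => hεδ X X₀ hX g hg hgper hg1) g

/-- The kernel vector represents the operator: `⟪κ_t(X), g⟫ = (e^{-tH} g)(X)`. [folklore] -/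
theorem inner_pfkKernelVec {v : ℝ → ℝ≥0∞} (hv : Measurable v) {L : ℝ} (hL : 0 < L) {t : ℝ}
    (ht : 0 < t) (X : Config N) (g : Lp ℝ 2 (volume.restrict (cellN N L))) :
    ⟪(InnerProductSpace.toDual ℝ (Lp ℝ 2 (volume.restrict (cellN N L)))).symm (pfkEval v L t X),
      g⟫_ℝ = pfkReal v L t (⇑g ∘ cellProj L) X := by
  rw [InnerProductSpace.toDual_symm_apply, pfkEval_apply hv hL ht]

/-! ### Compactness -/

/-- The closed cell `[0,L]^{3N}` is bounded: `‖X‖ ≤ √3 |L|` on it. [folklore] -/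
theorem isBounded_closedCellN (N : ℕ) (L : ℝ) :
    Bornology.IsBounded {X : Config N | ∀ i k, X i k ∈ Set.Icc 0 L} := by
  refine isBounded_iff_forall_norm_le.2 ⟨Real.sqrt 3 * |L|, fun X hX => ?_⟩
  refine (pi_norm_le_iff_of_nonneg (by positivity)).2 fun i => ?_
  rw [EuclideanSpace.norm_eq]
  have hk : ∀ k : Fin 3, ‖X i k‖ ^ 2 ≤ L ^ 2 := fun k => by
    have h := (hX i) k
    rw [Real.norm_eq_abs, sq_abs]
    nlinarith [h.1, h.2]
  calc Real.sqrt (∑ k, ‖X i k‖ ^ 2) ≤ Real.sqrt (∑ _k : Fin 3, L ^ 2) :=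
        Real.sqrt_le_sqrt (Finset.sum_le_sum fun k _ => hk k)
    _ = Real.sqrt 3 * |L| := by
        rw [Finset.sum_const, Finset.card_univ, Fintype.card_fin, nsmul_eq_mul, Nat.cast_ofNat,
          Real.sqrt_mul (by norm_num), Real.sqrt_sq_eq_abs]

/-- The closed cell `[0,L]^{3N}` is compact and contains the fundamental cell. [folklore] -/
theorem isCompact_closedCellN (N : ℕ) (L : ℝ) :
    IsCompact {X : Config N | ∀ i k, X i k ∈ Set.Icc 0 L} ∧
      cellN N L ⊆ {X : Config N | ∀ i k, X i k ∈ Set.Icc 0 L} := by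
  refine ⟨?_, fun X hX i k => ⟨(hX i k).1, (hX i k).2.le⟩⟩
  refine Metric.isCompact_of_isClosed_isBounded ?_ (isBounded_closedCellN N L)
  have hset : {X : Config N | ∀ i k, X i k ∈ Set.Icc 0 L} =
      ⋂ i : Fin N, ⋂ k : Fin 3, (fun X : Config N => X i k) ⁻¹' Set.Icc 0 L := by
    ext X; simp
  rw [hset]
  exact isClosed_iInter fun i => isClosed_iInter fun k =>
    isClosed_Icc.preimage ((PiLp.continuous_apply 2 _ k).comp (continuous_apply i))

/-- **`e^{-tH_N^per}` is a compact operator on `L²([0,L)^{3N})`** (`t > 0`, `L > 0`, bounded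
periodised pair potential `v^per ≤ C`): the criterion
`Literature.Analysis.FunctionSpaces.isCompactOperator_of_ae_eq_indicator_inner` on the compact
closed cell `[0,L]^{3N}` (which carries the whole measure `dX|_{cell}`) with the continuous kernel
vector `κ_t`. Chung–Zhao (1995), Prop 3.15 (`T_t` is compact on `L²(S)` when `m(S) < ∞`).
[cite: ChungZhao1995, Prop 3.15] -/
theorem isCompactOperator_pfkL2 {v : ℝ → ℝ≥0∞} (hv : Measurable v) {L : ℝ} (hL : 0 < L)
    {C : ℝ≥0} (hC : ∀ x, periodizedPotential v L x ≤ C) {t : ℝ} (ht : 0 < t) :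
    IsCompactOperator (pfkL2 v L t :
      Lp ℝ 2 (volume.restrict (cellN N L)) →L[ℝ] Lp ℝ 2 (volume.restrict (cellN N L))) := by
  haveI : IsFiniteMeasure (volume.restrict (cellN N L) : Measure (Config N)) :=
    ⟨by rw [Measure.restrict_apply_univ]; exact (volume_cellN_ne_top N L).lt_top⟩
  obtain ⟨hKc, hKsub⟩ := isCompact_closedCellN N L
  refine Literature.Analysis.FunctionSpaces.isCompactOperator_of_ae_eq_indicator_inner hKc
    (fun X => (InnerProductSpace.toDual ℝ (Lp ℝ 2 (volume.restrict (cellN N L)))).symm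
      (pfkEval v L t X))
    (continuous_pfkKernelVec hv hL hC ht).continuousOn (pfkL2 v L t) fun g => ?_
  filter_upwards [pfkL2_coeFn hv hL ht g, ae_restrict_mem (measurableSet_cellN N L)] with X h1 h2
  rw [h1, Set.indicator_of_mem (hKsub h2), inner_pfkKernelVec hv hL ht]

end Literature.MathematicalPhysics.QuantumManyBody.BoseGas

end
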